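import Summits.AtomisticToContinuum.Crystallization.Theses.PalmUnimodularRigidity
import Summits.AtomisticToContinuum.Crystallization.Theorems.MinimiserShells.Negative.LoadBearing
import Summits.AtomisticToContinuum.Crystallization.Theorems.MinimiserShells.Negative.Rootedness
import Summits.AtomisticToContinuum.Crystallization.Theorems.PalmUnimodularRigidityMinimiserShellsEquilibriumInLawAssembly
import Summits.AtomisticToContinuum.Crystallization.Theorems.PalmUnimodularRigidityMinimiserShellsEventTransferCell
import Literature.Probability.Process.PointStationaryLaw
import Literature.MathematicalPhysics.StatisticalMechanics.RootEnergy
import Literature.MathematicalPhysics.StatisticalMechanics.MuGSC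

/-!
# Slack event transfer I (cell level): the per-cell and pointwise inequalities for a slack-priced event

Helper file for stub `stub_slackEventTransfer` (S8a) of line `equilibrium-in-law-surgery` (lead reshape r4),
crux `MinimiserShells` (stmt-AtomisticToContinuum-9225).

This is `…EventTransferCell` (reshape r3, p115848) run with a per-site SLACK `s ≥ 0` in the pricing: if for the
fixed rooted `δ`-separated configuration `S` every finite window `C ⊆ S` and every set `G ⊆ C` of `R₀`-deep sites
at which the event `Ev` holds after re-rooting satisfy `#C · e* + c · #G ≤ ½ ∑∑_{C} V_LJ + s · #C`, then for every
mesh `L > 0`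

`ofReal(e* + Bshift) · vol(cube L) + ofReal(c) · cellAvg L Fev ≤ cellAvg L F₁ + cellAvg L F₂ + ofReal(s) · vol(cube L)`

(`pointwise_cell_inequality_slack`): the slack survives the division by the window size as `+ ofReal s` per phase and
the phase integral as `+ ofReal(s) · vol(cube L)`.  The case `s = 0` is the r3 inequality.  A THRESHOLD pricing
("deep-`Ev` fraction `≥ t` ⇒ excess energy density `≥ κ`") is such a slack pricing with `c = κ`, `s = κ t`, which is
why the law-level consequence `P(Ev) ≤ s / c = t` (file `…SlackEventTransfer`) kills every threshold-priced event.
-/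

noncomputable section

open MeasureTheory ProbabilityTheory
open scoped ENNReal BigOperators Classical

namespace Summit.AtomisticToContinuum.Crystallization.Theorems.PalmUnimodularRigidityMinimiserShells.SlackEventTransferCell

open Literature.Probability.Process (IsPointStationaryLaw IsRootedHardCore count_restrict_singleton_ne_zero_iff
  map_sub_count_restrict)
open Literature.MathematicalPhysics.StatisticalMechanics (lennardJones IsMuGSC UniformlyDiscrete)
open Summit.AtomisticToContinuum.Crystallization.Theses.PalmUnimodularRigidity (MinimiserShells UnimodularEnergyLowerBound)
open Summit.AtomisticToContinuum.Crystallization.Theorems.MinimiserShells.Negative.LoadBearing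
  (eStar meanRootEnergy GoodShell minimiserShells_iff)
open Summit.AtomisticToContinuum.Crystallization.Theorems.MinimiserShells.Negative.Rootedness (E3
  countable_of_separated)
open Summit.AtomisticToContinuum.Crystallization.Theorems.PalmUnimodularRigidityMinimiserShells.EquilibriumInLaw.LfKernel
  (lfKernel lfKernel_count_restrict)
open Summit.AtomisticToContinuum.Crystallization.Theorems.PalmUnimodularRigidityMinimiserShells.EquilibriumInLaw.Phase
  (cube cell cellIdx depth measurableSet_cube measurableSet_cell zero_mem_cell finite_inter_cell measurable_depth depth_nonneg)
open Summit.AtomisticToContinuum.Crystallization.Theorems.PalmUnimodularRigidityMinimiserShells.EquilibriumInLaw.Lattice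
  (latticeL depth_add_of_mem_latticeL volume_cube)
open Summit.AtomisticToContinuum.Crystallization.Theorems.PalmUnimodularRigidityMinimiserShells.EquilibriumInLaw.RootSums
  (Bδ Bδ_nonneg tailBound tailBound_nonneg CT CT_nonneg)
open Summit.AtomisticToContinuum.Crystallization.Theorems.PalmUnimodularRigidityMinimiserShells.EquilibriumInLaw.Cluster
  (tsum_sdiff_coe_eq_sum_add_tsum)
open Summit.AtomisticToContinuum.Crystallization.Theorems.PalmUnimodularRigidityMinimiserShells.EquilibriumInLaw.CellAverage
  (reroot reroot_eq_map measurable_reroot cellAvg measurable_cellAvg measurable_cellAvgIntegrand lintegral_cellAvg_eq)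
open Summit.AtomisticToContinuum.Crystallization.Theorems.PalmUnimodularRigidityMinimiserShells.EquilibriumInLaw.CellSums
  (hTilde Bshift eStar_add_Bshift_nonneg F₁ F₂ measurable_F₁ measurable_F₂ F₁_periodic F₂_periodic
  lintegral_cell_indicator count_restrict_cell cellAvg_count_restrict reroot_count_restrict F₁_reroot abs_tsum_le_Bδ)
open Summit.AtomisticToContinuum.Crystallization.Theorems.PalmUnimodularRigidityMinimiserShells.EquilibriumInLaw.WindowReal
  (inter_closedBall_subset_cell neg_tailBound_le_tsum)
open Summit.AtomisticToContinuum.Crystallization.Theorems.PalmUnimodularRigidityMinimiserShells.EquilibriumInLaw.Assembly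
  (setLIntegral_F₂_le volume_cube_le_deep_add lintegral_cellAvg_F₁ lintegral_cellAvg_F₂ lintegral_ofReal_hTilde_le)
open Summit.AtomisticToContinuum.Crystallization.Theorems.PalmUnimodularRigidityMinimiserShells.EventTransferCell
  (measurable_Fev)

/-! ## Cells are half-open cubes -/

/-- Membership in the root's cell of the grid `u + Lℤ³`, coordinate-wise: `cell L u` is the half-open cube
`∏_i [a_i, a_i + L)` with corner `a_i = u_i + L · ⌊−u_i / L⌋`. -/
theorem mem_cell_iff_corner {L : ℝ} (hL : 0 < L) (u z : E3) :
    z ∈ cell L u ↔ ∀ i, u i + L * (cellIdx L u 0 i : ℝ) ≤ z i ∧ z i < u i + L * (cellIdx L u 0 i : ℝ) + L := by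
  unfold cell
  simp only [Set.mem_setOf_eq]
  refine forall_congr' fun i => ?_
  rw [show cellIdx L u z i = ⌊(z i - u i) / L⌋ from rfl, Int.floor_eq_iff, le_div_iff₀ hL, div_lt_iff₀ hL]
  constructor
  · rintro ⟨h1, h2⟩
    exact ⟨by linarith, by nlinarith⟩
  · rintro ⟨h1, h2⟩
    exact ⟨by linarith, by nlinarith⟩

/-- The root's cell as a half-open cube with an explicit corner. -/
theorem cell_eq_box {L : ℝ} (hL : 0 < L) (u : E3) :
    cell L u = {z : E3 | ∀ i, (fun j => u j + L * (cellIdx L u 0 j : ℝ)) i ≤ z i ∧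
      z i < (fun j => u j + L * (cellIdx L u 0 j : ℝ)) i + L} :=
  Set.ext fun z => mem_cell_iff_corner hL u z

/-! ## The per-cell real inequality from slack pricing -/

/-- **The per-cell inequality from slack pricing.**  If deep `E`-sites of the CUBE windows of `S` of side `≥ L₀` are
priced at rate `c` beyond depth `R₀` up to a slack `s` per site of the window, then for every grid size `L ≥ L₀`,
`L > 0`, phase `u` and the window `C = S ∩ cell_u`:
`#C · e* + c · #{y ∈ C : R₀ < depth(u − y), θ_y count|S ∈ Ev} ≤ ∑_{y ∈ C} (½ ∑_{z ∈ S} V(|y − z|) + ½ tailBound δ ⌊depth⌋) + s · #C`. -/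
theorem cell_real_inequality_slack {δ : ℝ} (hδ : 0 < δ) {S : Set E3}
    (hsep : ∀ x ∈ S, ∀ z ∈ S, x ≠ z → δ ≤ dist x z) {Ev : Set (Measure E3)} {L₀ R₀ c s : ℝ}
    (hprice : ∀ L : ℝ, L₀ ≤ L → ∀ a : Fin 3 → ℝ, ∀ C : Finset E3,
      (↑C : Set E3) = S ∩ {z : E3 | ∀ i, a i ≤ z i ∧ z i < a i + L} → ∀ G : Finset E3, G ⊆ C →
      (∀ y ∈ G, (Measure.count : Measure E3).restrict ((fun z => z - y) '' S) ∈ Ev ∧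
        S ∩ Metric.closedBall y R₀ ⊆ ↑C) →
      (C.card : ℝ) * eStar + c * G.card ≤ (∑ x ∈ C, ∑ z ∈ C, lennardJones (dist x z)) / 2 + s * C.card)
    {L : ℝ} (hL : 0 < L) (hL₀ : L₀ ≤ L) (u : E3) (C : Finset E3) (hC : (↑C : Set E3) = S ∩ cell L u) :
    (C.card : ℝ) * eStar + c * (C.filter fun y => R₀ < depth L (u - y) ∧
        reroot ((Measure.count : Measure E3).restrict S, y) ∈ Ev).card ≤
      ∑ y ∈ C, ((∑' z : S, lennardJones (dist y z)) / 2 + tailBound δ ⌊depth L (u - y)⌋₊ / 2) + s * C.card := by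
  have hCS : (↑C : Set E3) ⊆ S := hC ▸ Set.inter_subset_left
  have hud : UniformlyDiscrete (S \ ↑C) := ⟨δ, hδ, fun x hx z hz hxz => hsep x hx.1 z hz.1 hxz⟩
  -- the deep event sites
  set G := C.filter (fun y => R₀ < depth L (u - y) ∧
    reroot ((Measure.count : Measure E3).restrict S, y) ∈ Ev) with hG
  have hGC : G ⊆ C := Finset.filter_subset _ _
  have hGdeep : ∀ y ∈ G, (Measure.count : Measure E3).restrict ((fun z => z - y) '' S) ∈ Ev ∧
      S ∩ Metric.closedBall y R₀ ⊆ ↑C := by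
    intro y hy
    obtain ⟨hyC, hdep, hev⟩ := Finset.mem_filter.1 hy
    refine ⟨?_, ?_⟩
    · rwa [reroot_count_restrict hδ hsep y] at hev
    · have hycell : y ∈ cell L u := (hC ▸ (Finset.mem_coe.2 hyC) : y ∈ S ∩ cell L u).2
      rw [hC]
      exact inter_closedBall_subset_cell hL hycell hdep
  have key := hprice L hL₀ (fun j => u j + L * (cellIdx L u 0 j : ℝ)) C (by rw [hC, cell_eq_box hL u]) G hGC hGdeep
  -- the root energies of the atoms of `C`
  have hsplit : ∀ y ∈ C, ∑' z : S, lennardJones (dist y z) =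
      ∑ z ∈ C, lennardJones (dist y z) + ∑' z : ↥(S \ ↑C), lennardJones (dist y z) := by
    intro y _
    have h := tsum_sdiff_coe_eq_sum_add_tsum hCS (Finset.empty_subset C) (fun z => lennardJones (dist y z))
      (hud.summable_lennardJones y)
    rw [Finset.sdiff_empty] at h
    rw [← h]
    exact tsum_congr_set_coe (fun z => lennardJones (dist y z)) (by rw [Finset.coe_empty, Set.sdiff_empty])
  have htail : ∀ y ∈ C, -tailBound δ ⌊depth L (u - y)⌋₊ ≤ ∑' z : ↥(S \ ↑C), lennardJones (dist y z) :=
    fun y hy => neg_tailBound_le_tsum hδ hL hsep hC hy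
  have hsum : (∑ x ∈ C, ∑ z ∈ C, lennardJones (dist x z)) / 2 ≤
      ∑ y ∈ C, ((∑' z : S, lennardJones (dist y z)) / 2 + tailBound δ ⌊depth L (u - y)⌋₊ / 2) := by
    rw [Finset.sum_div]
    refine Finset.sum_le_sum fun y hy => ?_
    rw [hsplit y hy]
    linarith [htail y hy]
  linarith

/-! ## The pointwise cell inequality -/

/-- **The pointwise cell inequality with slack** for the configuration `count|S` of a rooted `δ`-separated `S`
whose deep `E`-sites are priced on cube windows of side `≥ L₀` up to a per-site slack `s ≥ 0`: for every
`L ≥ L₀`, `L > 0`,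
`ofReal(e* + Bshift) · vol(cube L) + ofReal(c) · cellAvg L Fev ≤ cellAvg L F₁ + cellAvg L F₂ + ofReal(s) · vol(cube L)`. -/
theorem pointwise_cell_inequality_slack {δ : ℝ} (hδ : 0 < δ) {S : Set E3} (h0 : (0 : E3) ∈ S)
    (hsep : ∀ x ∈ S, ∀ z ∈ S, x ≠ z → δ ≤ dist x z) {Ev : Set (Measure E3)} (hE : MeasurableSet Ev)
    {L₀ R₀ c s : ℝ} (hc : 0 < c) (hs : 0 ≤ s)
    (hprice : ∀ L : ℝ, L₀ ≤ L → ∀ a : Fin 3 → ℝ, ∀ C : Finset E3,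
      (↑C : Set E3) = S ∩ {z : E3 | ∀ i, a i ≤ z i ∧ z i < a i + L} → ∀ G : Finset E3, G ⊆ C →
      (∀ y ∈ G, (Measure.count : Measure E3).restrict ((fun z => z - y) '' S) ∈ Ev ∧
        S ∩ Metric.closedBall y R₀ ⊆ ↑C) →
      (C.card : ℝ) * eStar + c * G.card ≤ (∑ x ∈ C, ∑ z ∈ C, lennardJones (dist x z)) / 2 + s * C.card)
    {L : ℝ} (hL : 0 < L) (hL₀ : L₀ ≤ L) :
    ENNReal.ofReal (eStar + Bshift δ) * volume (cube L) +
        ENNReal.ofReal c * cellAvg L (fun (μ : Measure E3) (u : E3) => Ev.indicator (1 : Measure E3 → ℝ≥0∞) μ * {u : E3 | R₀ < depth L u}.indicator (1 : E3 → ℝ≥0∞) u) ((Measure.count : Measure E3).restrict S) ≤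
      cellAvg L (F₁ δ) ((Measure.count : Measure E3).restrict S) +
        cellAvg L (F₂ δ L) ((Measure.count : Measure E3).restrict S) + ENNReal.ofReal s * volume (cube L) := by
  have hκ := lfKernel_count_restrict hδ hsep
  -- notation for the windows
  set C : E3 → Finset E3 := fun u => (finite_inter_cell hL hδ hsep u).toFinset with hCdef
  have hCcoe : ∀ u, (↑(C u) : Set E3) = S ∩ cell L u := fun u => (finite_inter_cell hL hδ hsep u).coe_toFinset
  have hCne : ∀ u, ((C u).card : ℝ≥0∞) ≠ 0 := by
    intro u h
    have h0C : (0 : E3) ∈ C u := by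
      rw [← Finset.mem_coe, hCcoe]; exact ⟨h0, zero_mem_cell L u⟩
    rw [Nat.cast_eq_zero, Finset.card_eq_zero] at h
    rw [h] at h0C
    exact absurd h0C (Finset.notMem_empty _)
  have hCtop : ∀ u, ((C u).card : ℝ≥0∞) ≠ ∞ := fun u => ENNReal.natCast_ne_top _
  -- the three integrands
  rw [cellAvg_count_restrict hL hδ hsep (F₁ δ), cellAvg_count_restrict hL hδ hsep (F₂ δ L),
    cellAvg_count_restrict hL hδ hsep (fun (μ : Measure E3) (u : E3) => Ev.indicator (1 : Measure E3 → ℝ≥0∞) μ * {u : E3 | R₀ < depth L u}.indicator (1 : E3 → ℝ≥0∞) u)]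
  -- measurability of the integrands in the phase
  have hmeas : ∀ {F : Measure E3 → E3 → ℝ≥0∞}, Measurable (Function.uncurry F) →
      Measurable fun u : E3 => (((C u).card : ℝ≥0∞))⁻¹ *
        ∑ y ∈ C u, F (reroot ((Measure.count : Measure E3).restrict S, y)) (u - y) := by
    intro F hF
    have h := (measurable_cellAvgIntegrand (L := L) hF).comp
      (measurable_const.prodMk measurable_id :
        Measurable fun u : E3 => ((Measure.count : Measure E3).restrict S, u))
    have heq : (fun u : E3 => (((C u).card : ℝ≥0∞))⁻¹ *
        ∑ y ∈ C u, F (reroot ((Measure.count : Measure E3).restrict S, y)) (u - y)) =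
        (fun a : Measure E3 × E3 => (lfKernel a.1 (cell L a.2))⁻¹ *
          ∫⁻ y, (cell L a.2).indicator (fun y => F (reroot (a.1, y)) (a.2 - y)) y ∂(lfKernel a.1)) ∘
          fun u : E3 => ((Measure.count : Measure E3).restrict S, u) := by
      funext u
      simp only [Function.comp_apply, hκ, count_restrict_cell hL hδ hsep u, lintegral_cell_indicator hL hδ hsep u,
        hCdef]
    rw [heq]
    exact h
  -- pointwise in the phase
  have hpw : ∀ u, ENNReal.ofReal (eStar + Bshift δ) + ENNReal.ofReal c *
      ((((C u).card : ℝ≥0∞))⁻¹ * ∑ y ∈ C u,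
        (fun (μ : Measure E3) (u : E3) => Ev.indicator (1 : Measure E3 → ℝ≥0∞) μ * {u : E3 | R₀ < depth L u}.indicator (1 : E3 → ℝ≥0∞) u) (reroot ((Measure.count : Measure E3).restrict S, y)) (u - y)) ≤
      (((C u).card : ℝ≥0∞))⁻¹ * ∑ y ∈ C u, F₁ δ (reroot ((Measure.count : Measure E3).restrict S, y)) (u - y) +
      (((C u).card : ℝ≥0∞))⁻¹ * ∑ y ∈ C u, F₂ δ L (reroot ((Measure.count : Measure E3).restrict S, y)) (u - y) +
      ENNReal.ofReal s := by
    intro u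
    -- the real inequality of the cell
    have hreal := cell_real_inequality_slack hδ hsep hprice hL hL₀ u (C u) (hCcoe u)
    set G := (C u).filter (fun y => R₀ < depth L (u - y) ∧
      reroot ((Measure.count : Measure E3).restrict S, y) ∈ Ev) with hG
    -- rewrite the three sums
    have hS1 : ∑ y ∈ C u, F₁ δ (reroot ((Measure.count : Measure E3).restrict S, y)) (u - y) =
        ∑ y ∈ C u, ENNReal.ofReal ((∑' z : S, lennardJones (dist y z)) / 2 + Bshift δ) :=
      Finset.sum_congr rfl fun y _ => F₁_reroot hδ hsep y _
    have hS2 : ∑ y ∈ C u, F₂ δ L (reroot ((Measure.count : Measure E3).restrict S, y)) (u - y) =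
        ∑ y ∈ C u, ENNReal.ofReal (tailBound δ ⌊depth L (u - y)⌋₊) := rfl
    have hS3 : ∑ y ∈ C u, (fun (μ : Measure E3) (u : E3) => Ev.indicator (1 : Measure E3 → ℝ≥0∞) μ * {u : E3 | R₀ < depth L u}.indicator (1 : E3 → ℝ≥0∞) u) (reroot ((Measure.count : Measure E3).restrict S, y)) (u - y) =
        (G.card : ℝ≥0∞) := by
      rw [hG, Finset.natCast_card_filter]
      refine Finset.sum_congr rfl fun y _ => ?_
      simp only [Set.indicator_apply, Set.mem_setOf_eq, Pi.one_apply, mul_ite, mul_one, mul_zero]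
      by_cases h1 : reroot ((Measure.count : Measure E3).restrict S, y) ∈ Ev <;>
        by_cases h2 : R₀ < depth L (u - y) <;> simp [h1, h2]
    rw [hS1, hS2, hS3]
    -- non-negativity of the summands
    have hpos1 : ∀ y ∈ C u, 0 ≤ (∑' z : S, lennardJones (dist y z)) / 2 + Bshift δ := by
      intro y hy
      have hyS : y ∈ S := ((hCcoe u) ▸ (Finset.mem_coe.2 hy) : y ∈ S ∩ cell L u).1
      have hb := abs_tsum_le_Bδ hδ hsep hyS
      rw [abs_le] at hb
      unfold Bshift
      have ha := abs_nonneg eStar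
      linarith [hb.1]
    -- the real inequality, shifted
    have hreal' : ((C u).card : ℝ) * (eStar + Bshift δ) + c * G.card ≤
        ∑ y ∈ C u, (((∑' z : S, lennardJones (dist y z)) / 2 + Bshift δ) + tailBound δ ⌊depth L (u - y)⌋₊) +
          s * (C u).card := by
      have h1 : ∑ y ∈ C u, (((∑' z : S, lennardJones (dist y z)) / 2 + Bshift δ) +
          tailBound δ ⌊depth L (u - y)⌋₊) =
          ∑ y ∈ C u, ((∑' z : S, lennardJones (dist y z)) / 2 + tailBound δ ⌊depth L (u - y)⌋₊) +
            (C u).card * Bshift δ := by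
        rw [Finset.sum_add_distrib, Finset.sum_add_distrib, Finset.sum_add_distrib, Finset.sum_const,
          nsmul_eq_mul]
        ring
      have h2 : ∑ y ∈ C u, ((∑' z : S, lennardJones (dist y z)) / 2 + tailBound δ ⌊depth L (u - y)⌋₊ / 2) ≤
          ∑ y ∈ C u, ((∑' z : S, lennardJones (dist y z)) / 2 + tailBound δ ⌊depth L (u - y)⌋₊) :=
        Finset.sum_le_sum fun y _ => by linarith [tailBound_nonneg δ ⌊depth L (u - y)⌋₊]
      rw [h1]
      linarith
    -- pass to `ℝ≥0∞`
    have hsumnn : 0 ≤ ∑ y ∈ C u, (((∑' z : S, lennardJones (dist y z)) / 2 + Bshift δ) +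
        tailBound δ ⌊depth L (u - y)⌋₊) :=
      Finset.sum_nonneg fun y hy => add_nonneg (hpos1 y hy) (tailBound_nonneg δ _)
    have hofReal := ENNReal.ofReal_le_ofReal hreal'
    rw [ENNReal.ofReal_add (mul_nonneg (Nat.cast_nonneg _) (eStar_add_Bshift_nonneg δ))
        (mul_nonneg hc.le (Nat.cast_nonneg _)), ENNReal.ofReal_mul (Nat.cast_nonneg _), ENNReal.ofReal_natCast,
      ENNReal.ofReal_mul hc.le, ENNReal.ofReal_natCast,
      ENNReal.ofReal_add hsumnn (mul_nonneg hs (Nat.cast_nonneg _)), ENNReal.ofReal_mul hs, ENNReal.ofReal_natCast,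
      ENNReal.ofReal_sum_of_nonneg (fun y hy => add_nonneg (hpos1 y hy) (tailBound_nonneg δ _))] at hofReal
    have hsplit : ∑ y ∈ C u, ENNReal.ofReal (((∑' z : S, lennardJones (dist y z)) / 2 + Bshift δ) +
        tailBound δ ⌊depth L (u - y)⌋₊) =
        ∑ y ∈ C u, ENNReal.ofReal ((∑' z : S, lennardJones (dist y z)) / 2 + Bshift δ) +
          ∑ y ∈ C u, ENNReal.ofReal (tailBound δ ⌊depth L (u - y)⌋₊) := by
      rw [← Finset.sum_add_distrib]
      exact Finset.sum_congr rfl fun y hy => ENNReal.ofReal_add (hpos1 y hy) (tailBound_nonneg δ _)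
    rw [hsplit] at hofReal
    -- divide by the window size
    set k : ℝ≥0∞ := (((C u).card : ℝ≥0∞))⁻¹ with hk
    have hk1 : k * ((C u).card : ℝ≥0∞) = 1 := ENNReal.inv_mul_cancel (hCne u) (hCtop u)
    calc ENNReal.ofReal (eStar + Bshift δ) + ENNReal.ofReal c * (k * (G.card : ℝ≥0∞))
        = k * ((C u).card : ℝ≥0∞) * ENNReal.ofReal (eStar + Bshift δ) + ENNReal.ofReal c * (k * (G.card : ℝ≥0∞)) := by
          rw [hk1, one_mul]
      _ = k * (((C u).card : ℝ≥0∞) * ENNReal.ofReal (eStar + Bshift δ) + ENNReal.ofReal c * (G.card : ℝ≥0∞)) := by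
          ring
      _ ≤ k * (∑ y ∈ C u, ENNReal.ofReal ((∑' z : S, lennardJones (dist y z)) / 2 + Bshift δ) +
            ∑ y ∈ C u, ENNReal.ofReal (tailBound δ ⌊depth L (u - y)⌋₊) +
            ENNReal.ofReal s * ((C u).card : ℝ≥0∞)) := mul_le_mul' le_rfl hofReal
      _ = k * ∑ y ∈ C u, ENNReal.ofReal ((∑' z : S, lennardJones (dist y z)) / 2 + Bshift δ) +
            k * ∑ y ∈ C u, ENNReal.ofReal (tailBound δ ⌊depth L (u - y)⌋₊) +
            ENNReal.ofReal s * (k * ((C u).card : ℝ≥0∞)) := by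
          ring
      _ = _ := by rw [hk1, mul_one]
  -- integrate over the phase cube
  have hI3 := hmeas (measurable_Fev L R₀ hE)
  have hI1 := hmeas (measurable_F₁ δ)
  have hI2 := hmeas (measurable_F₂ δ L)
  calc ENNReal.ofReal (eStar + Bshift δ) * volume (cube L) + ENNReal.ofReal c *
        ∫⁻ u in cube L, (((C u).card : ℝ≥0∞))⁻¹ *
          ∑ y ∈ C u, (fun (μ : Measure E3) (u : E3) => Ev.indicator (1 : Measure E3 → ℝ≥0∞) μ * {u : E3 | R₀ < depth L u}.indicator (1 : E3 → ℝ≥0∞) u) (reroot ((Measure.count : Measure E3).restrict S, y)) (u - y)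
      = ∫⁻ u in cube L, (ENNReal.ofReal (eStar + Bshift δ) + ENNReal.ofReal c *
          ((((C u).card : ℝ≥0∞))⁻¹ * ∑ y ∈ C u,
            (fun (μ : Measure E3) (u : E3) => Ev.indicator (1 : Measure E3 → ℝ≥0∞) μ * {u : E3 | R₀ < depth L u}.indicator (1 : E3 → ℝ≥0∞) u) (reroot ((Measure.count : Measure E3).restrict S, y)) (u - y))) := by
        rw [lintegral_add_left measurable_const, setLIntegral_const, lintegral_const_mul _ hI3]
    _ ≤ ∫⁻ u in cube L, ((((C u).card : ℝ≥0∞))⁻¹ *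
          ∑ y ∈ C u, F₁ δ (reroot ((Measure.count : Measure E3).restrict S, y)) (u - y) +
        (((C u).card : ℝ≥0∞))⁻¹ *
          ∑ y ∈ C u, F₂ δ L (reroot ((Measure.count : Measure E3).restrict S, y)) (u - y) +
        ENNReal.ofReal s) :=
        lintegral_mono fun u => hpw u
    _ = _ := by
        rw [lintegral_add_right _ measurable_const, setLIntegral_const, lintegral_add_left hI1]

/-- Registered stub marker (helper part 01 of `stub_slackEventTransfer`, line `equilibrium-in-law-surgery`, reshape r4):
the pointwise cell inequality for a slack-priced event, `pointwise_cell_inequality_slack`, closed form. -/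
theorem stub_slackEventTransfer_part01 :
    ∀ (δ : ℝ), 0 < δ → ∀ (S : Set (EuclideanSpace ℝ (Fin 3))), (0 : EuclideanSpace ℝ (Fin 3)) ∈ S →
      (∀ x ∈ S, ∀ z ∈ S, x ≠ z → δ ≤ dist x z) → ∀ (Ev : Set (Measure (EuclideanSpace ℝ (Fin 3)))), MeasurableSet Ev →
      ∀ (L₀ R₀ c s : ℝ), 0 < c → 0 ≤ s →
      (∀ L : ℝ, L₀ ≤ L → ∀ a : Fin 3 → ℝ, ∀ C : Finset (EuclideanSpace ℝ (Fin 3)),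
        (↑C : Set (EuclideanSpace ℝ (Fin 3))) = S ∩ {z : EuclideanSpace ℝ (Fin 3) | ∀ i, a i ≤ z i ∧ z i < a i + L} →
        ∀ G : Finset (EuclideanSpace ℝ (Fin 3)), G ⊆ C →
          (∀ y ∈ G, (Measure.count : Measure (EuclideanSpace ℝ (Fin 3))).restrict ((fun z => z - y) '' S) ∈ Ev ∧
            S ∩ Metric.closedBall y R₀ ⊆ ↑C) →
          (C.card : ℝ) * eStar + c * G.card ≤ (∑ x ∈ C, ∑ z ∈ C, lennardJones (dist x z)) / 2 + s * C.card) →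
      ∀ (L : ℝ), 0 < L → L₀ ≤ L →
      ENNReal.ofReal (eStar + Bshift δ) * volume (cube L) +
          ENNReal.ofReal c * cellAvg L (fun (μ : Measure (EuclideanSpace ℝ (Fin 3))) (u : EuclideanSpace ℝ (Fin 3)) => Ev.indicator (1 : Measure (EuclideanSpace ℝ (Fin 3)) → ℝ≥0∞) μ * {u : EuclideanSpace ℝ (Fin 3) | R₀ < depth L u}.indicator (1 : EuclideanSpace ℝ (Fin 3) → ℝ≥0∞) u)
            ((Measure.count : Measure (EuclideanSpace ℝ (Fin 3))).restrict S) ≤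
        cellAvg L (F₁ δ) ((Measure.count : Measure (EuclideanSpace ℝ (Fin 3))).restrict S) +
          cellAvg L (F₂ δ L) ((Measure.count : Measure (EuclideanSpace ℝ (Fin 3))).restrict S) +
          ENNReal.ofReal s * volume (cube L) :=
  fun _ hδ _ h0 hsep _ hE _ _ _ _ hc hs hprice _ hL hL₀ => pointwise_cell_inequality_slack hδ h0 hsep hE hc hs hprice hL hL₀

end Summit.AtomisticToContinuum.Crystallization.Theorems.PalmUnimodularRigidityMinimiserShells.SlackEventTransferCell

end
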